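import Summits.PneNP.PneNP.Theorems.SymmetryBudgetNoHiddenOrderCertifiedLabelsDefs

/-!
# Certified per-path labels: the min-leaf solution subtree and pass-over heights (theorems)

Route `PneNP/SymmetryBudget`, item `NoHiddenOrder` (stmt-PneNP-14781); definitions and context in
`SymmetryBudgetNoHiddenOrderCertifiedLabelsDefs.lean`, memo ANALYSIS-4 (evidence on the item).

* **Prop. B** `AOTree.pathCost_le_leaves`: for a min-leaf selector, along every root–leaf path of its
  solution subtree the product of the OR-degrees is at most the number of leaves of the whole tree
  (`leaves ν = Σ_children leaves ≥ d_ν · leaves(min child)` at OR nodes, `≥ leaves(part)` at AND nodes);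
  `AOTree.exists_isMinLeaf`, `AOTree.exists_selector_pathCost_le`.
* **Lemma C / decoding lemma** for a `PassOverPath`: heights strictly decrease along pass-overs
  (`height_lt_of_passOver`), so among the candidates `j ≥ i` with `x j ∈ A i` seen by the replay at step
  `i`, the step `i` is the unique one of maximal height (`eq_of_height_le`); and `height i + 1 ≤ |A i|`
  (`height_succ_le_card`: a passed-over cell lies in the passing cell minus its vertex,
  `A_subset_erase`), which feeds the disorder bound `dis ≤ t + 2 Σ log₂ |A i|` of
  `AdviceEntropy.factorial_le_prod_factorial_mul_two_pow`.

Mathlib + the Defs file only; supports stmt-PneNP-14781 (does not close it).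
-/

-- `Summit.PneNP.PneNP.…` duplicates `PneNP` BY DESIGN (single-problem summit, D-0017 layout).
set_option linter.dupNamespace false

namespace Summit.PneNP.PneNP.Theorems

namespace CertifiedLabels

open Finset

namespace AOTree

/-- A min-leaf selector exists. -/
theorem exists_isMinLeaf : ∃ sel : Selector, IsMinLeaf sel := by
  classical
  have key : ∀ (n : ℕ) (c : Fin n → AOTree), n ≠ 0 → ∃ j : Fin n, ∀ i, leaves (c j) ≤ leaves (c i) := by
    intro n c h
    have hne : (univ : Finset (Fin n)).Nonempty := by
      rw [univ_nonempty_iff]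
      exact ⟨⟨0, Nat.pos_of_ne_zero h⟩⟩
    obtain ⟨j, -, hj⟩ := exists_min_image univ (fun i => leaves (c i)) hne
    exact ⟨j, fun i => hj i (mem_univ i)⟩
  exact ⟨fun n c h => (key n c h).choose, fun n c h i => (key n c h).choose_spec i⟩

/-- **Prop. B.** Along every root–leaf path of the min-leaf solution subtree the product of the
OR-degrees is at most the number of leaves of the whole tree. -/
theorem pathCost_le_leaves {sel : Selector} (hsel : IsMinLeaf sel) : ∀ T : AOTree, pathCost sel T ≤ leaves T
  | leaf => le_rfl
  | orNode n c => by
      simp only [pathCost, leaves]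
      split_ifs with h
      · exact Nat.zero_le _
      · calc n * pathCost sel (c (sel n c h))
            ≤ n * leaves (c (sel n c h)) := Nat.mul_le_mul_left _ (pathCost_le_leaves hsel _)
          _ = ∑ _i : Fin n, leaves (c (sel n c h)) := by simp
          _ ≤ ∑ i : Fin n, leaves (c i) := sum_le_sum fun i _ => hsel n c h i
  | andNode n c => by
      simp only [pathCost, leaves]
      refine Finset.sup_le fun i _ => ?_
      calc pathCost sel (c i) ≤ leaves (c i) := pathCost_le_leaves hsel _
        _ ≤ ∑ j : Fin n, leaves (c j) :=
            single_le_sum (f := fun j => leaves (c j)) (fun j _ => Nat.zero_le _) (mem_univ i)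

/-- Prop. B with the selector packaged: some solution subtree has all its path products bounded by the
number of leaves. -/
theorem exists_selector_pathCost_le : ∃ sel : Selector, ∀ T : AOTree, pathCost sel T ≤ leaves T := by
  obtain ⟨sel, hsel⟩ := exists_isMinLeaf
  exact ⟨sel, pathCost_le_leaves hsel⟩

end AOTree

namespace PassOverPath

variable {V : Type*} {t : ℕ} (P : PassOverPath V t)

/-- The vertices of distinct steps are distinct. -/
theorem x_injective : Function.Injective P.x := by
  intro i j hij
  by_contra hne
  rcases lt_or_gt_of_ne hne with h | h
  · exact P.gone i j h (hij ▸ P.mem j)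
  · exact P.gone j i h (hij.symm ▸ P.mem i)

variable [DecidableEq V]

/-- A passed-over cell lies inside the passing cell minus its vertex. -/
theorem A_subset_erase {i j : Fin t} (h : P.PassOver i j) : P.A j ⊆ (P.A i).erase (P.x i) := by
  intro v hv
  rw [mem_erase]
  refine ⟨?_, P.nest i j h.1 h.2 hv⟩
  rintro rfl
  exact P.gone i j h.1 hv

/-- Hence a passed-over cell is strictly smaller. -/
theorem card_lt_of_passOver {i j : Fin t} (h : P.PassOver i j) : (P.A j).card < (P.A i).card := by
  have := card_le_card (P.A_subset_erase h)
  rw [card_erase_of_mem (P.mem i)] at this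
  have hpos : 0 < (P.A i).card := card_pos.2 ⟨_, P.mem i⟩
  omega

/-- **Heights strictly decrease along pass-overs** (so `height` is an anti-layering of the pass-over
forest: condition (C1) of ANALYSIS-4 §2). -/
theorem height_lt_of_passOver {i j : Fin t} (h : P.PassOver i j) : P.height j < P.height i := by
  rw [P.height_eq i]
  have hj : j ∈ univ.filter fun j => P.PassOver i j := mem_filter.2 ⟨mem_univ _, h⟩
  have := Finset.le_sup (f := fun j : {j // j ∈ univ.filter fun j => P.PassOver i j} => P.height j.1 + 1)
    (mem_attach _ ⟨j, hj⟩)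
  exact this

/-- **Decoding lemma.** At step `i` the replay sees the candidates `j ≥ i` with `x j ∈ A i` (the vertex
taken now and the later-individualised vertices of the cell); among them `i` is the unique one of
maximal height. -/
theorem eq_of_height_le {i j : Fin t} (hij : i ≤ j) (hx : P.x j ∈ P.A i) (hle : P.height i ≤ P.height j) :
    j = i := by
  rcases hij.lt_or_eq with hlt | heq
  · exact absurd (P.height_lt_of_passOver ⟨hlt, hx⟩) (not_lt.2 hle)
  · exact heq.symm

/-- The candidates at step `i` other than `i` itself have strictly smaller height. -/
theorem height_lt_of_candidate {i j : Fin t} (hij : i < j) (hx : P.x j ∈ P.A i) :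
    P.height j < P.height i :=
  P.height_lt_of_passOver ⟨hij, hx⟩

/-- **Lemma C (height bound).** `height i + 1 ≤ |A i|`: a pass-over chain from `i` runs through
distinct vertices of `A i ∖ {x i}`. -/
theorem height_succ_le_card (i : Fin t) : P.height i + 1 ≤ (P.A i).card := by
  induction hn : t - i.1 using Nat.strong_induction_on generalizing i with
  | _ n ih =>
    rw [P.height_eq i]
    have hpos : 0 < (P.A i).card := card_pos.2 ⟨_, P.mem i⟩
    -- every term of the sup is at most `|A i| - 1`
    have hsup : ((univ.filter fun j => P.PassOver i j).attach.sup fun j => P.height j.1 + 1) ≤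
        (P.A i).card - 1 := by
      refine Finset.sup_le fun j _ => ?_
      have hj : P.PassOver i j.1 := (mem_filter.1 j.2).2
      have hlt : (P.A j.1).card < (P.A i).card := P.card_lt_of_passOver hj
      have hji : (j.1 : Fin t).1 > i.1 := hj.1
      have hrec := ih (t - (j.1 : Fin t).1) (by subst hn; have := (j.1 : Fin t).2; omega) j.1 rfl
      omega
    omega

end PassOverPath

end CertifiedLabels

end Summit.PneNP.PneNP.Theorems
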